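import Summits.CriticalPhenomena.Ising3DConformalLimit.Theorems.ArmHyperscalingOneArmHyperscalingMirrorFaceDefs
import Summits.CriticalPhenomena.Ising3DConformalLimit.Theorems.HyperoctahedralRPCriticalCorrNineMirrorRP
import Literature.Probability.LatticeModels.PlusStateFKG
import HarnessLib

/-!
# Reflection positivity with the patch indicator: `(N + N')² ≤ 4 ⟨σ₀σ_{2ne₀}⟩ ⟨𝟙_{A⁺} 𝟙_{θA⁺}⟩`
(route ArmHyperscaling, crux `OneArmHyperscaling`, item stmt-CriticalPhenomena-15591, line
`mirror-face-saturation` (Casimir variant), registered stub `rp_indicator_cs`)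

Statement (`rp_indicator_cs`): on `ℤ³` at `β_c(3)`, `h = 0`, for `K ≥ 2`, `n ≥ 1`, with
`x = evalSite n = n e₀`, `θx = -n e₀`, `A = mirrorPatch K n ⊂ {y₀ > 0}`, `θA = facePatch K n`,
`N = ⟨σ_x 𝟙_{θA⁺}⟩_{β_c}`, `N' = ⟨σ_{θx} 𝟙_{A⁺}⟩_{β_c}`, `P = ⟨σ₀ σ_{2ne₀}⟩_{β_c}`,
`B = ⟨𝟙_{A⁺} 𝟙_{θA⁺}⟩_{β_c}` (`𝟙_{S⁺} = plusIndicator S`):  `(N + N')² ≤ 4 P B`.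

Proof. Reflection positivity of the critical state in the site mirror `θ : y ↦ (-y₀, y₁, y₂)`
(Fröhlich–Israel–Lieb–Simon 1978, Thm. 3.1; tree theorem `criticalCorrNineMirrorRP_proof`, item
stmt-CriticalPhenomena-1985) for the family of spin monomials `{x}` (coefficient `t`) and `σ_C`,
`C ⊆ A` (coefficient `2^{-|A|}`), all supported in `{y₀ > 0}`: with the Walsh expansion
`𝟙_{A⁺} = 2^{-|A|} Σ_{C ⊆ A} σ_C` (Friedli–Velenik 2017, Lemma 3.19) and linearity of the
critical state on observables whose box sequences converge (`hasBoxLimit_isingCorr_plus_holds`),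
the Gram form is `t² P + t (N' + N) + B ≥ 0` for every real `t` (`P = ⟨σ_{θx} σ_x⟩ = ⟨σ₀ σ_{2ne₀}⟩`
by translation invariance, `𝟙_{A⁺} ∘ θ = 𝟙_{θA⁺}`); the discriminant inequality is the claim.
References: J. Fröhlich, R. Israel, E. H. Lieb, B. Simon, Comm. Math. Phys. 62 (1978) 1–34,
Thm. 3.1; S. Friedli, Y. Velenik, *Statistical Mechanics of Lattice Systems* (CUP 2017),
Lemma 3.19, Thm. 3.17.  No definitions are introduced: the mirror `θ` is written
`fun y => Function.update y 0 (-(y 0))`, the reflected configuration `σ ∘ θ` as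
`fun y => σ (Function.update y 0 (-(y 0)))`.
-/
noncomputable section

namespace Summit.CriticalPhenomena.Ising3DConformalLimit.Cruxes.OneArmHyperscaling.MirrorFaceSaturation

open Literature.Probability.LatticeModels Finset Filter Topology
open scoped symmDiff
open Summit.CriticalPhenomena.Ising3DConformalLimit.HyperoctahedralRPNineMirror
  (criticalCorrNineMirrorRP_proof)

/-! ### The mirror on sites, configurations and spin products -/

/-- The site mirror `θ y = (-y₀, y₁, y₂)` is an involution. [folklore] -/
private theorem mirror_invol :
    Function.Involutive (fun y : Site 3 => Function.update y 0 (-(y 0))) := fun y => by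
  simp

/-- A reflected spin: `σ_z (σ ∘ θ) = σ_{θz} (σ)`. [folklore] -/
private theorem spinAt_comp_mirror (z : Site 3) (σ : SpinConfig (Site 3)) :
    spinAt z (fun y => σ (Function.update y 0 (-(y 0)))) =
      spinAt (Function.update z 0 (-(z 0))) σ := rfl

/-- A one-site spin product is the spin. [folklore] -/
private theorem spinProduct_singleton' (z : Site 3) (σ : SpinConfig (Site 3)) :
    spinProduct {z} σ = spinAt z σ := Finset.prod_singleton _ _

/-- A reflected spin product is the spin product of the reflected set. [folklore] -/
private theorem spinProduct_comp_mirror (S : Finset (Site 3)) (σ : SpinConfig (Site 3)) :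
    spinProduct S (fun y => σ (Function.update y 0 (-(y 0)))) =
      spinProduct (S.image fun y : Site 3 => Function.update y 0 (-(y 0))) σ := by
  unfold spinProduct
  rw [Finset.prod_image fun y _ z _ h => mirror_invol.injective h]
  rfl

/-- `σ_S (σ ∘ θ) · σ_T (σ) = σ_{θS ∆ T} (σ)` (`σ_y² = 1`). [folklore] -/
private theorem mirror_mul_eq_spinProduct (S T : Finset (Site 3)) :
    (fun σ : SpinConfig (Site 3) =>
        spinProduct S (fun y => σ (Function.update y 0 (-(y 0)))) * spinProduct T σ) =
      spinProduct (S.image (fun y : Site 3 => Function.update y 0 (-(y 0))) ∆ T) := by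
  funext σ
  rw [← spinProduct_mul_eq_spinProduct_symmDiff, spinProduct_comp_mirror]

/-- Measurability of `σ ↦ σ_S (σ ∘ θ) σ_T (σ)`. [folklore] -/
private theorem measurable_mirror_mul (S T : Finset (Site 3)) :
    Measurable fun σ : SpinConfig (Site 3) =>
      spinProduct S (fun y => σ (Function.update y 0 (-(y 0)))) * spinProduct T σ := by
  rw [mirror_mul_eq_spinProduct]
  exact measurable_spinProduct _

/-- The spin monomial of the concatenation of an enumeration of `θS` and an enumeration of `T` is
`σ_S (σ ∘ θ) · σ_T (σ)`. [folklore] -/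
private theorem spinMonomial_append_enum (S T : Finset (Site 3)) (σ : SpinConfig (Site 3)) :
    spinMonomial (Fin.append
      (fun i => Function.update ((S.equivFin.symm i : S) : Site 3) 0
        (-(((S.equivFin.symm i : S) : Site 3) 0)))
      (fun j => ((T.equivFin.symm j : T) : Site 3))) σ =
      spinProduct S (fun y => σ (Function.update y 0 (-(y 0)))) * spinProduct T σ := by
  simp only [spinMonomial]
  rw [Fin.prod_univ_add]
  simp only [Fin.append_left, Fin.append_right]
  congr 1
  · rw [spinProduct, ← Finset.prod_coe_sort S]
    exact Fintype.prod_equiv S.equivFin.symm _ _ fun i => rfl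
  · rw [spinProduct, ← Finset.prod_coe_sort T]
    exact Fintype.prod_equiv T.equivFin.symm _ _ fun j => rfl

/-! ### The critical state on these observables -/

/-- `⟨∏ σ_{θS ++ T}⟩_{β_c} = ⟨σ_S (· ∘ θ) σ_T⟩_{β_c}` (same integrand). [folklore] -/
private theorem criticalCorr_append_enum (S T : Finset (Site 3)) :
    criticalCorr 3 (#S + #T) (Fin.append
      (fun i => Function.update ((S.equivFin.symm i : S) : Site 3) 0
        (-(((S.equivFin.symm i : S) : Site 3) 0)))
      (fun j => ((T.equivFin.symm j : T) : Site 3))) =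
      critExpect (fun σ =>
        spinProduct S (fun y => σ (Function.update y 0 (-(y 0)))) * spinProduct T σ) := by
  change plusExpect 3 (criticalBeta 3) 0 _ = plusExpect 3 (criticalBeta 3) 0 _
  exact congrArg _ (funext fun σ => spinMonomial_append_enum S T σ)

/-- **Existence of the critical state on `σ_S (· ∘ θ) σ_T`**: the box sequence
`⟨σ_S (· ∘ θ) σ_T⟩⁺_{Λ_L; β_c, 0} = ⟨σ_{θS ∆ T}⟩⁺_{Λ_L}` converges to the critical expectation
(Friedli–Velenik 2017, Thm. 3.17; tree `hasBoxLimit_isingCorr_plus_holds`).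
[cite: FriedliVelenik2017, Thm. 3.17] -/
private theorem tendsto_mirror_mul (S T : Finset (Site 3)) :
    Tendsto (fun L : ℕ => isingExpect (zdGraph 3) (box 3 L) (criticalBeta 3) 0 .plus
      (fun σ => spinProduct S (fun y => σ (Function.update y 0 (-(y 0)))) * spinProduct T σ))
      atTop (𝓝 (critExpect (fun σ =>
        spinProduct S (fun y => σ (Function.update y 0 (-(y 0)))) * spinProduct T σ))) := by
  rw [mirror_mul_eq_spinProduct]
  exact hasBoxLimit_isingCorr_plus_holds (criticalBeta_nonneg 3) le_rfl _

/-- **Linearity of the critical state on observables with convergent box sequences**: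
`⟨Σ_i c_i f_i⟩_{β_c} = Σ_i c_i ⟨f_i⟩_{β_c}` whenever each `⟨f_i⟩⁺_{Λ_L; β_c, 0}` converges
(finite-volume expectations are linear; the `limUnder` of a convergent sequence is its limit). -/
private theorem critExpect_linear {ι : Type*} (s : Finset ι) (c : ι → ℝ)
    (f : ι → SpinConfig (Site 3) → ℝ) (hf : ∀ i, Measurable (f i))
    (hlim : ∀ i ∈ s, Tendsto (fun L : ℕ => isingExpect (zdGraph 3) (box 3 L) (criticalBeta 3) 0
      .plus (f i)) atTop (𝓝 (critExpect (f i)))) :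
    critExpect (fun σ => ∑ i ∈ s, c i * f i σ) = ∑ i ∈ s, c i * critExpect (f i) := by
  have hlin : ∀ L : ℕ, isingExpect (zdGraph 3) (box 3 L) (criticalBeta 3) 0 .plus
      (fun σ => ∑ i ∈ s, c i * f i σ) =
        ∑ i ∈ s, c i * isingExpect (zdGraph 3) (box 3 L) (criticalBeta 3) 0 .plus (f i) := by
    intro L
    rw [isingExpect_finset_sum' _ _ _ _ _ s (fun i σ => c i * f i σ) fun i => (hf i).const_mul _]
    exact Finset.sum_congr rfl fun i _ => isingExpect_const_mul' _ _ _ _ _ (c i) (hf i)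
  have ht : Tendsto (fun L : ℕ => isingExpect (zdGraph 3) (box 3 L) (criticalBeta 3) 0 .plus
      (fun σ => ∑ i ∈ s, c i * f i σ)) atTop (𝓝 (∑ i ∈ s, c i * critExpect (f i))) := by
    simp_rw [hlin]
    exact tendsto_finsetSum _ fun i hi => (hlim i hi).const_mul _
  exact ht.limUnder_eq

/-- **Reflection positivity of the critical state in the site mirror `{y₀ = 0}` for spin products
indexed by a finite type**: for finite sets `X_a ⊂ {y₀ > 0}` and real `c_a`,
`0 ≤ Σ_{a,b} c_a c_b ⟨σ_{X_a} (· ∘ θ) σ_{X_b}⟩_{β_c}` (Fröhlich–Israel–Lieb–Simon 1978, Thm. 3.1;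
the tree theorem `criticalCorrNineMirrorRP_proof`, fed the enumerations of the `X_a` and reindexed
along `ι ≃ Fin |ι|`). [cite: FrohlichEtAl1978, §3 Thm 3.1] -/
private theorem rp_finsets {ι : Type*} [Fintype ι] (X : ι → Finset (Site 3)) (c : ι → ℝ)
    (hX : ∀ a, ∀ y ∈ X a, 0 < y 0) :
    0 ≤ ∑ a, ∑ b, c a * c b * critExpect (fun σ =>
      spinProduct (X a) (fun y => σ (Function.update y 0 (-(y 0)))) * spinProduct (X b) σ) := by
  have h := criticalCorrNineMirrorRP_proof (fun y => Function.update y 0 (-y 0)) (fun y => y 0)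
    ⟨0, 1, by decide, Or.inl ⟨rfl, rfl⟩⟩ (Fintype.card ι)
    (fun a => #(X ((Fintype.equivFin ι).symm a)))
    (fun a i => (((X ((Fintype.equivFin ι).symm a)).equivFin.symm i :
      X ((Fintype.equivFin ι).symm a)) : Site 3))
    (fun a => c ((Fintype.equivFin ι).symm a))
    (fun a i => hX _ _ ((X ((Fintype.equivFin ι).symm a)).equivFin.symm i).2)
  refine h.trans_eq (Fintype.sum_equiv (Fintype.equivFin ι).symm _ _ fun a =>
    Fintype.sum_equiv (Fintype.equivFin ι).symm _ _ fun b => ?_)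
  exact congrArg (fun r => c ((Fintype.equivFin ι).symm a) * c ((Fintype.equivFin ι).symm b) * r)
    (criticalCorr_append_enum _ _)

/-! ### The two patches and the evaluation site under the mirror -/

/-- Members of `facePatch K n`: `y₀ = n - Kn - 1`, `|y₁|, |y₂| ≤ Kn`. [folklore] -/
private theorem facePatch_mem_iff {K n : ℕ} {y : Site 3} :
    y ∈ facePatch K n ↔ y 0 = (n : ℤ) - ((K * n : ℕ) : ℤ) - 1 ∧
      (-((K * n : ℕ) : ℤ) ≤ y 1 ∧ y 1 ≤ ((K * n : ℕ) : ℤ)) ∧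
      (-((K * n : ℕ) : ℤ) ≤ y 2 ∧ y 2 ≤ ((K * n : ℕ) : ℤ)) := by
  simp [facePatch, Fintype.mem_piFinset, Fin.forall_fin_succ]

/-- Members of `mirrorPatch K n`: `y₀ = Kn + 1 - n`, `|y₁|, |y₂| ≤ Kn`. [folklore] -/
private theorem mirrorPatch_mem_iff {K n : ℕ} {y : Site 3} :
    y ∈ mirrorPatch K n ↔ y 0 = ((K * n : ℕ) : ℤ) + 1 - (n : ℤ) ∧
      (-((K * n : ℕ) : ℤ) ≤ y 1 ∧ y 1 ≤ ((K * n : ℕ) : ℤ)) ∧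
      (-((K * n : ℕ) : ℤ) ≤ y 2 ∧ y 2 ≤ ((K * n : ℕ) : ℤ)) := by
  simp [mirrorPatch, Fintype.mem_piFinset, Fin.forall_fin_succ]

/-- `θ` maps the mirror patch into the face patch. [folklore] -/
private theorem mirror_maps_mirrorPatch {K n : ℕ} {y : Site 3} (hy : y ∈ mirrorPatch K n) :
    Function.update y 0 (-(y 0)) ∈ facePatch K n := by
  -- adapted from the landed sibling `…StubMirrorCauchySchwarz` (`mirror_mem_facePatch`)
  rw [mirrorPatch_mem_iff] at hy
  have h1 : Function.update y 0 (-(y 0)) 1 = y 1 := Function.update_of_ne (by decide) _ _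
  have h2 : Function.update y 0 (-(y 0)) 2 = y 2 := Function.update_of_ne (by decide) _ _
  rw [facePatch_mem_iff, Function.update_self, h1, h2]
  omega

/-- `θ` maps the face patch into the mirror patch. [folklore] -/
private theorem mirror_maps_facePatch {K n : ℕ} {y : Site 3} (hy : y ∈ facePatch K n) :
    Function.update y 0 (-(y 0)) ∈ mirrorPatch K n := by
  rw [facePatch_mem_iff] at hy
  have h1 : Function.update y 0 (-(y 0)) 1 = y 1 := Function.update_of_ne (by decide) _ _
  have h2 : Function.update y 0 (-(y 0)) 2 = y 2 := Function.update_of_ne (by decide) _ _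
  rw [mirrorPatch_mem_iff, Function.update_self, h1, h2]
  omega

/-- **`𝟙_{A⁺} ∘ θ = 𝟙_{θA⁺}`**: the mirror patch is plus in the reflected configuration iff the
face patch is plus (`θ : A → θA` is a bijection). [folklore] -/
private theorem plusIndicator_mirrorPatch_comp (K n : ℕ) (σ : SpinConfig (Site 3)) :
    plusIndicator (mirrorPatch K n) (fun y => σ (Function.update y 0 (-(y 0)))) =
      plusIndicator (facePatch K n) σ := by
  unfold plusIndicator
  exact Finset.prod_nbij' (fun y => Function.update y 0 (-(y 0)))
    (fun y => Function.update y 0 (-(y 0))) (fun y hy => mirror_maps_mirrorPatch hy)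
    (fun y hy => mirror_maps_facePatch hy) (fun y _ => mirror_invol y) (fun y _ => mirror_invol y)
    (fun y _ => rfl)

/-- `θ x = -n e₀` for the evaluation site `x = n e₀`. [folklore] -/
private theorem mirror_evalSite_eq (n : ℕ) :
    Function.update (evalSite n) 0 (-(evalSite n 0)) = Pi.single 0 (-(n : ℤ)) := by
  funext i
  by_cases hi : i = 0
  · subst hi
    simp [evalSite]
  · rw [Function.update_of_ne hi, evalSite, Pi.single_eq_of_ne hi, Pi.single_eq_of_ne hi]

/-- **Walsh expansion of the patch indicator** (Friedli–Velenik 2017, Lemma 3.19, inverse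
direction): `𝟙_{S⁺} = ∏_{y∈S} (1+σ_y)/2 = 2^{-|S|} Σ_{C ⊆ S} σ_C`.
[cite: FriedliVelenik2017, Lemma 3.19] -/
private theorem plusIndicator_eq_pow_mul_sum (S : Finset (Site 3)) (σ : SpinConfig (Site 3)) :
    plusIndicator S σ = (1 / 2 : ℝ) ^ #S * ∑ C ∈ S.powerset, spinProduct C σ := by
  -- adapted from the landed sibling `…StubFaceLimit` (`plusIndicator_eq_sum_spinProduct`)
  have h1 : plusIndicator S σ = (∏ y ∈ S, (spinAt y σ + 1)) * ∏ _y ∈ S, (1 / 2 : ℝ) := by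
    rw [plusIndicator, ← Finset.prod_mul_distrib]
    exact Finset.prod_congr rfl fun y _ => by ring
  rw [h1, Finset.prod_const, mul_comm, Finset.prod_add]
  congr 1
  refine Finset.sum_congr rfl fun C _ => ?_
  rw [Finset.prod_const_one, mul_one]
  rfl

/-! ### Identification of the four coefficients of the Gram form -/

/-- `criticalCorr 3 2 ![a, b] = ⟨σ₀ σ_{b-a}⟩_{β_c}` (translation invariance of the plus state,
Friedli–Velenik 2017 Thm. 3.17, tree `plusPair_eq_twoPointPlus_sub`).
[cite: FriedliVelenik2017, Thm. 3.17] -/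
private theorem critCorr_pair_eq (a b : Site 3) :
    criticalCorr 3 2 ![a, b] = criticalTwoPoint 3 (b - a) := by
  -- adapted from `criticalCorr_two_pair` (Literature/.../HighDimPointwiseTriviality)
  have h1 : criticalCorr 3 2 ![a, b] = plusPair 3 (criticalBeta 3) a b := by
    change plusExpect 3 (criticalBeta 3) 0 (spinMonomial ![a, b]) =
      plusExpect 3 (criticalBeta 3) 0 (spinPair a b)
    congr 1
    funext s
    simp [spinMonomial, spinPair, Fin.prod_univ_two]
  rw [h1, plusPair_eq_twoPointPlus_sub (criticalBeta_nonneg 3)]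
  rfl

/-- **`P`**: `⟨σ_{θx} σ_x⟩_{β_c} = ⟨σ₀ σ_{2ne₀}⟩_{β_c}` for `x = n e₀`. [folklore] -/
private theorem piece_point_point (n : ℕ) :
    critExpect (fun σ => spinProduct {evalSite n} (fun y => σ (Function.update y 0 (-(y 0)))) *
        spinProduct {evalSite n} σ) =
      criticalTwoPoint 3 (Pi.single 0 (2 * (n : ℤ))) := by
  have hfun : (fun σ => spinProduct {evalSite n} (fun y => σ (Function.update y 0 (-(y 0)))) *
      spinProduct {evalSite n} σ) = spinMonomial ![Pi.single 0 (-(n : ℤ)), evalSite n] := by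
    funext σ
    rw [spinProduct_singleton', spinProduct_singleton', spinAt_comp_mirror, mirror_evalSite_eq]
    simp [spinMonomial, Fin.prod_univ_two]
  rw [hfun]
  change criticalCorr 3 2 ![Pi.single 0 (-(n : ℤ)), evalSite n] = _
  rw [critCorr_pair_eq]
  congr 1
  funext i
  by_cases hi : i = 0
  · subst hi
    simp [evalSite]
    ring
  · simp [evalSite, Pi.single_eq_of_ne hi]

/-- **`N'`**: `Σ_{C ⊆ A} 2^{-|A|} ⟨σ_{θx} σ_C⟩_{β_c} = ⟨σ_{θx} 𝟙_{A⁺}⟩_{β_c}` (Walsh expansion and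
linearity). [folklore] -/
private theorem piece_point_patch (K n : ℕ) :
    ∑ C : (mirrorPatch K n).powerset, (1 / 2 : ℝ) ^ #(mirrorPatch K n) *
        critExpect (fun σ =>
          spinProduct {evalSite n} (fun y => σ (Function.update y 0 (-(y 0)))) *
            spinProduct (C : Finset (Site 3)) σ) =
      critExpect (fun σ => spinAt (Pi.single 0 (-(n : ℤ))) σ *
        plusIndicator (mirrorPatch K n) σ) := by
  refine (critExpect_linear Finset.univ (fun _ => (1 / 2 : ℝ) ^ #(mirrorPatch K n))
    (fun (C : (mirrorPatch K n).powerset) σ =>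
      spinProduct {evalSite n} (fun y => σ (Function.update y 0 (-(y 0)))) *
        spinProduct (C : Finset (Site 3)) σ)
    (fun C => measurable_mirror_mul _ _) (fun C _ => tendsto_mirror_mul _ _)).symm.trans ?_
  refine congrArg critExpect (funext fun σ => ?_)
  rw [plusIndicator_eq_pow_mul_sum, ← Finset.sum_coe_sort (mirrorPatch K n).powerset,
    Finset.mul_sum, Finset.mul_sum]
  refine Finset.sum_congr rfl fun C _ => ?_
  rw [spinProduct_singleton', spinAt_comp_mirror, mirror_evalSite_eq]
  ring

/-- **`N`**: `Σ_{C ⊆ A} 2^{-|A|} ⟨σ_C (· ∘ θ) σ_x⟩_{β_c} = ⟨σ_x 𝟙_{θA⁺}⟩_{β_c}` (Walsh expansion,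
`𝟙_{A⁺} ∘ θ = 𝟙_{θA⁺}` and linearity). [folklore] -/
private theorem piece_patch_point (K n : ℕ) :
    ∑ C : (mirrorPatch K n).powerset, (1 / 2 : ℝ) ^ #(mirrorPatch K n) *
        critExpect (fun σ =>
          spinProduct (C : Finset (Site 3)) (fun y => σ (Function.update y 0 (-(y 0)))) *
            spinProduct {evalSite n} σ) =
      critExpect (fun σ => spinAt (evalSite n) σ * plusIndicator (facePatch K n) σ) := by
  refine (critExpect_linear Finset.univ (fun _ => (1 / 2 : ℝ) ^ #(mirrorPatch K n))
    (fun (C : (mirrorPatch K n).powerset) σ =>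
      spinProduct (C : Finset (Site 3)) (fun y => σ (Function.update y 0 (-(y 0)))) *
        spinProduct {evalSite n} σ)
    (fun C => measurable_mirror_mul _ _) (fun C _ => tendsto_mirror_mul _ _)).symm.trans ?_
  refine congrArg critExpect (funext fun σ => ?_)
  rw [← plusIndicator_mirrorPatch_comp, plusIndicator_eq_pow_mul_sum,
    ← Finset.sum_coe_sort (mirrorPatch K n).powerset, Finset.mul_sum, Finset.mul_sum]
  refine Finset.sum_congr rfl fun C _ => ?_
  rw [spinProduct_singleton']
  ring

/-- **`B`**: `Σ_{C, C' ⊆ A} 4^{-|A|} ⟨σ_C (· ∘ θ) σ_{C'}⟩_{β_c} = ⟨𝟙_{A⁺} 𝟙_{θA⁺}⟩_{β_c}` (Walsh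
expansion twice, `𝟙_{A⁺} ∘ θ = 𝟙_{θA⁺}` and linearity). [folklore] -/
private theorem piece_patch_patch (K n : ℕ) :
    ∑ C : (mirrorPatch K n).powerset, ∑ C' : (mirrorPatch K n).powerset,
        (1 / 2 : ℝ) ^ #(mirrorPatch K n) * (1 / 2 : ℝ) ^ #(mirrorPatch K n) *
          critExpect (fun σ =>
            spinProduct (C : Finset (Site 3)) (fun y => σ (Function.update y 0 (-(y 0)))) *
              spinProduct (C' : Finset (Site 3)) σ) =
      critExpect (fun σ =>
        plusIndicator (mirrorPatch K n) σ * plusIndicator (facePatch K n) σ) := by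
  rw [← Fintype.sum_prod_type']
  refine (critExpect_linear Finset.univ
    (fun _ => (1 / 2 : ℝ) ^ #(mirrorPatch K n) * (1 / 2 : ℝ) ^ #(mirrorPatch K n))
    (fun (p : (mirrorPatch K n).powerset × (mirrorPatch K n).powerset) σ =>
      spinProduct (p.1 : Finset (Site 3)) (fun y => σ (Function.update y 0 (-(y 0)))) *
        spinProduct (p.2 : Finset (Site 3)) σ)
    (fun p => measurable_mirror_mul _ _) (fun p _ => tendsto_mirror_mul _ _)).symm.trans ?_
  refine congrArg critExpect (funext fun σ => ?_)
  rw [Fintype.sum_prod_type, ← plusIndicator_mirrorPatch_comp, plusIndicator_eq_pow_mul_sum,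
    plusIndicator_eq_pow_mul_sum, ← Finset.sum_coe_sort (mirrorPatch K n).powerset,
    ← Finset.sum_coe_sort (mirrorPatch K n).powerset, Finset.mul_sum, Finset.mul_sum,
    Finset.sum_mul_sum, Finset.sum_comm]
  refine Finset.sum_congr rfl fun C _ => Finset.sum_congr rfl fun C' _ => ?_
  dsimp only
  ring

/-! ### The stub -/

/-- **`rp_indicator_cs`** (registered stub of the line `mirror-face-saturation`, Casimir variant,
crux `OneArmHyperscaling`, item stmt-CriticalPhenomena-15591): for `K ≥ 2`, `n ≥ 1`,
`(⟨σ_x 𝟙_{θA⁺}⟩ + ⟨σ_{θx} 𝟙_{A⁺}⟩)² ≤ 4 ⟨σ₀σ_{2ne₀}⟩ ⟨𝟙_{A⁺} 𝟙_{θA⁺}⟩` at `β_c(3)`, with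
`x = n e₀`, `θx = -n e₀`, `A = mirrorPatch K n`, `θA = facePatch K n`: the Gram form of the
positive-side observables `(σ_x, 𝟙_{A⁺})` against their mirror images is positive semidefinite by
reflection positivity (Fröhlich–Israel–Lieb–Simon 1978, Thm. 3.1; tree
`criticalCorrNineMirrorRP_proof`), i.e. `0 ≤ t² P + t (N + N') + B` for all real `t`, and the
discriminant inequality concludes. [cite: FrohlichEtAl1978, §3 Thm 3.1] -/
theorem rp_indicator_cs : ∀ K n : ℕ, 2 ≤ K → 1 ≤ n → (critExpect (fun σ => spinAt (evalSite n) σ * plusIndicator (facePatch K n) σ) + critExpect (fun σ => spinAt (Pi.single 0 (-(n : ℤ))) σ * plusIndicator (mirrorPatch K n) σ)) ^ 2 ≤ 4 * criticalTwoPoint 3 (Pi.single 0 (2 * (n : ℤ))) * critExpect (fun σ => plusIndicator (mirrorPatch K n) σ * plusIndicator (facePatch K n) σ) := by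
  intro K n hK hn
  have hKn : n ≤ K * n := Nat.le_mul_of_pos_left n (by omega)
  have hx : 0 < evalSite n 0 := by rw [evalSite, Pi.single_eq_same]; exact_mod_cast hn
  have hA : ∀ y ∈ mirrorPatch K n, 0 < y 0 := fun y hy => by
    rw [mirrorPatch_mem_iff] at hy
    omega
  -- the Gram form `t² P + t (N + N') + B` is nonnegative for every real `t`
  have quad : ∀ t : ℝ, 0 ≤ criticalTwoPoint 3 (Pi.single 0 (2 * (n : ℤ))) * (t * t) +
      (critExpect (fun σ => spinAt (evalSite n) σ * plusIndicator (facePatch K n) σ) +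
        critExpect (fun σ => spinAt (Pi.single 0 (-(n : ℤ))) σ *
          plusIndicator (mirrorPatch K n) σ)) * t +
      critExpect (fun σ =>
        plusIndicator (mirrorPatch K n) σ * plusIndicator (facePatch K n) σ) := by
    intro t
    have h := rp_finsets (ι := Option (mirrorPatch K n).powerset)
      (fun o => o.elim {evalSite n} Subtype.val)
      (fun o => o.elim t fun _ => (1 / 2 : ℝ) ^ #(mirrorPatch K n)) (fun o => by
        cases o with
        | none =>
          intro y hy
          rw [Option.elim_none, Finset.mem_singleton] at hy
          exact hy ▸ hx
        | some C => exact fun y hy => hA y (Finset.mem_powerset.1 C.2 hy))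
    simp only [Fintype.sum_option, Option.elim_none, Option.elim_some, Finset.sum_add_distrib] at h
    have e2 : ∑ C : (mirrorPatch K n).powerset, t * (1 / 2 : ℝ) ^ #(mirrorPatch K n) *
        critExpect (fun σ =>
          spinProduct {evalSite n} (fun y => σ (Function.update y 0 (-(y 0)))) *
            spinProduct (C : Finset (Site 3)) σ) =
        t * critExpect (fun σ => spinAt (Pi.single 0 (-(n : ℤ))) σ *
          plusIndicator (mirrorPatch K n) σ) := by
      rw [← piece_point_patch, Finset.mul_sum]
      exact Finset.sum_congr rfl fun C _ => by ring
    have e3 : ∑ C : (mirrorPatch K n).powerset, (1 / 2 : ℝ) ^ #(mirrorPatch K n) * t *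
        critExpect (fun σ =>
          spinProduct (C : Finset (Site 3)) (fun y => σ (Function.update y 0 (-(y 0)))) *
            spinProduct {evalSite n} σ) =
        t * critExpect (fun σ => spinAt (evalSite n) σ * plusIndicator (facePatch K n) σ) := by
      rw [← piece_patch_point, Finset.mul_sum]
      exact Finset.sum_congr rfl fun C _ => by ring
    rw [piece_point_point, e2, e3, piece_patch_patch] at h
    linarith
  have hd := discrim_le_zero quad
  rw [discrim] at hd
  linarith

end Summit.CriticalPhenomena.Ising3DConformalLimit.Cruxes.OneArmHyperscaling.MirrorFaceSaturation

end
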